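import Literature.AlgebraicGeometry.ModuliOfAbelianVarieties.SiegelUniversalFamilyChartCoverOfPiece
import Literature.AlgebraicGeometry.ModuliOfAbelianVarieties.SiegelPeriodLinearAvatarFamily
import Literature.AlgebraicGeometry.ModuliOfAbelianVarieties.SiegelAdmissibleChartCompatibility
import Literature.AlgebraicGeometry.AbelianSchemes.AbelianSchemeEndomorphismOfChartReadings
import Literature.AlgebraicGeometry.Motives.VarietiesGeometricallyIntegralProofs
import HarnessLib

/-!
# COV-6 «ONE CALL PER PIECE»: the endomorphism of the pulled-back universal Siegel family over a disc-quotient piece read from an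
# integral lattice endomorphism `A` — charts (★ COV-2), avatar families (★ COV-3∕4), chart compatibility (★ COV-5) and ★ E6-an′ in ONE theorem
# ([BirkenhakeLange2004] §1.2 Prop. 1.2.1; [Shimura1963AnalyticFamilies] §2; [Lange2023AbelianVarietiesComplex] §3.4)

Topic `Literature/AlgebraicGeometry/ModuliOfAbelianVarieties`; namespace `Literature.AlgebraicGeometry.ModuliOfAbelianVarieties`.
THEOREMS ONLY (no definition, no named fact, no instance, no notation, no `sorry`); ★ P-3 `siegelUniversalFamilyUniformisation` enters as the
HYPOTHESIS `hP3` (D-0014).  Cell `hodgecm-mathlib` (D-0151), FLOOR 0, P6 «MOD» (crux hLiu418 = stmt-HodgeConjecture-24832, `--supports`), E6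
closer of `Cruxes/HLiu418/Lines/F0_P6a_PELWitnessE.lean`, socket Σ-AN `ReadsCReading`, census row **COV-6** (A-p06 (g33) `CENSUS-SigmaAN.v1`:
«★ E6-an′ at `(T, P_T.A)` with the cover `{(W, σ)}`, one call given COV-1…5»).  HC_CM is proved only modulo the printed citations (2 remaining
named inputs hLiu418 24832, h413 24833) until rung 0 closes; this file is generic and changes no count.

THE MATHEMATICS.  Setting of ★ COV-2 `exists_univFamilyChartCover_of_piece` (a disc-quotient piece `T = X_q` with ball datum `B`, its slice
`ψ : T ⟶ S_c` with holomorphic Siegel lift `Z`, the pulled-back universal triple `P_T`, analytifications `φT`, `φA`).  Let `A ∈ M_{2g}(ℤ)` be an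
integral lattice endomorphism which is `ℂ`-LINEAR for the complex structure of every `Z v`, `v` in the cone (an avatar `C_v ∘ Π_{Z v} = Π_{Z v} ∘ A_ℝ`
exists — ★ `AuxChartGS.Mρ_kottwitz`, first conjunct) and which COMMUTES WITH THE MONODROMY: two cone vectors over one point of `T` have period
points related by some `M ∈ Γ_δ(N)` (with its `ℂ`-linear part `L`) commuting with `A` (★ `AuxChartGS.Z_equivariant` read through the
`pieces` clause of ★ `RecordSystemGS`, cf. ★ COV-5 §4).  Then ([Shimura1963AnalyticFamilies] §2: an endomorphism of the period lattice commuting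
with the monodromy defines an endomorphism of the family; [BirkenhakeLange2004] Prop. 1.2.1 fibrewise; GAGA on the projective total space)
there is an ENDOMORPHISM `Y` of the abelian scheme `P_T.A → T`, a homomorphism, whose analytic representation in every ★ P-3 chart of the
section-domain cover is the avatar of `A`: `φA (ex_i (t, C_i t z)) = φA (ex_i (t, z)) ≫ Y`.  Assembly: ★ COV-2 (charts, sections, (G), (ADM) on
the cover indexed by the points of `MT`), ★ COV-3∕4 `exists_clm_family_along_lift` (the holomorphic avatar family `C_i` with its integral period
law `N_i = A`), ★ COV-5 `chart_apply_eq_of_chart_eq_of_periodMap_rel_of_injective` (compatibility on common fibres from the commuting transport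
and the two (ADM) markings at a principal representative `r` of `c`), ★ E6-an′ `exists_isMonHom_of_chartReadings_of_additive`.  The output keeps
the whole COV-2 list (so the reading clause RD reads `Y` through THE admissible markings) together with `C`, `Y` and the chart recipe.

* §1 **`exists_isMonHom_of_piece_readings`** — THE HEAD.

## References
* [BirkenhakeLange2004] C. Birkenhake, H. Lange, *Complex Abelian Varieties*, 2nd ed. (2004), §1.2 Proposition 1.2.1.
* [Shimura1963AnalyticFamilies] G. Shimura, *On analytic families of polarized abelian varieties and automorphic functions*, Ann. Math. 78 (1963), §2.
* [Lange2023AbelianVarietiesComplex] H. Lange, *Abelian Varieties over the Complex Numbers* (2023), §3.4 Prop. 3.4.1 p. 186, Lemma 3.4.7 and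
  Prop. 3.4.8 pp. 189–191.
* [Milne2005ShimuraVarieties] J. S. Milne, *Introduction to Shimura Varieties* (2005; rev. 2017), §6 Thm. 6.11 pp. 74–75.
-/

set_option autoImplicit false

noncomputable section

open CategoryTheory CategoryTheory.Limits AlgebraicGeometry Matrix Topology
open scoped Manifold ContDiff Matrix.Norms.Elementwise
open Literature.AlgebraicGeometry.Motives (SchemeOver ComplexPoints AlgPoints specOver AbelianVariety CartierDivisor IsSmoothProjective)
open Literature.AlgebraicGeometry.AbelianSchemes (PolarizedAbelianSchemeWithLevel AbelianSchemeOver)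
open Literature.AlgebraicGeometry.ShimuraVarieties (UnitaryBallUniformisationDatum negCone isOpen_negCone)
open Literature.Geometry.Kaehler (ComplexTorus)
open Literature.Geometry.Kaehler.ComplexTorus (cover)
open Literature.Geometry.ComplexAnalytic (IsRelExpChartOn totalOver basePoint)
open Literature.NumberTheory.Transcendental (IsAnalytification)
open Literature.NumberTheory.Automorphic (siegelUpperHalfSpace)
open Literature.NumberTheory.Adeles (latticeOfGL)

namespace Literature.AlgebraicGeometry.ModuliOfAbelianVarieties

open SiegelModuli (jOfSiegel)

/-! ### §1 THE HEAD: one call per piece -/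

/-- **COV-6 «ONE CALL PER PIECE» — THE ENDOMORPHISM OF THE PULLED-BACK UNIVERSAL FAMILY OVER A DISC-QUOTIENT PIECE READ FROM AN INTEGRAL LATTICE
ENDOMORPHISM COMMUTING WITH THE MONODROMY.**  Hypotheses: the ★ COV-2 list (★ P-3 as `hP3`, the Siegel piece with its (U2+)∕(U3) clauses, the disc
quotient `(T, B)`, the slice `ψ` with Siegel lift `Z`, the analytifications `φT`, `φA`), the smooth projectivity of the total space (★ E6-Π
`isSmoothProjective_total` in the closer), a principal representative `(u, r)` of the piece index `c` (the five (U3) premisses — `AuxChartGS.rep_spec`),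
an integral `A ∈ M_{2g}(ℤ)` with a `ℂ`-linear avatar at every cone vector (`hK`, the first conjunct of `AuxChartGS.Mρ_kottwitz`), and the COMMUTING
TRANSPORT LAW `htrans` (two cone vectors with the same image in `T(ℂ)` have period points related by `M ∈ Γ_δ(N)`, `L ∘ Π_{Z v} = Π_{Z v′} ∘ M`,
`M A = A M` — `AuxChartGS.Z_equivariant` through ★ COV-5 §4).  Conclusion: the COV-2 chart-cover data `(U, σ, Φ, ex)` with all its clauses
(sections, tautological periods, (C), (G), (ADM)), the avatar families `C i t` (`C i t ∘ Π_{Z (σ i t)} = Π_{Z (σ i t)} ∘ A_ℝ` on `U i`), and an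
ENDOMORPHISM `Y : P_T.A.X ⟶ P_T.A.X`, `IsMonHom Y`, inducing every chart recipe `(φA (ex i (t, C i t z))).left = (φA (ex i (t, z))).left ≫ Y.left`.
[cite: BirkenhakeLange2004, §1.2 Proposition 1.2.1] [cite: Shimura1963AnalyticFamilies, §2]
[cite: Lange2023AbelianVarietiesComplex, Prop. 3.4.1 p. 186 + Lemma 3.4.7 + Prop. 3.4.8 pp. 189–191 + Ex. 3.4.5 (7) p. 191 (universality); cf. Thm. 3.1.2 p. 163]
[cite: Milne2005ShimuraVarieties, §6 Thm. 6.11 pp. 74–75] -/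
theorem exists_isMonHom_of_piece_readings (hP3 : siegelUniversalFamilyUniformisation)
    (g N : ℕ) (δ : Fin g → ℕ) (hg : 0 < g) (hδ : IsPolarizationType δ) (hN : 3 ≤ N) (𝓜 : SiegelFineModuliScheme g N δ)
    -- a piece of `𝓜 ⊗ ℂ` with its uniformisation, satisfying the (U2+) clauses of ★ `siegelModuli_complexUniformisation`
    (c : (ZMod N)ˣ) (Sc : SchemeOver ℂ) (ιc : Sc ⟶ (Motives.baseChange ℚ ℂ).obj 𝓜.M)
    (unif : Matrix (Fin g) (Fin g) ℂ → ComplexPoints Sc)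
    (unif_cont : ContinuousOn unif (siegelUpperHalfSpace g)) (unif_open : IsOpenMap ((siegelUpperHalfSpace g).restrict unif))
    (unif_surj : Set.SurjOn unif (siegelUpperHalfSpace g) Set.univ)
    (unif_iff : ∀ Z ∈ siegelUpperHalfSpace g, ∀ Z' ∈ siegelUpperHalfSpace g,
      unif Z = unif Z' ↔ ∃ M ∈ siegelLevelGroup δ N, ∃ C : (Fin g → ℂ) ≃ₗ[ℂ] (Fin g → ℂ),
        ∀ v : Fin g ⊕ Fin g → ℝ, C (siegelPeriodMap δ Z v) = siegelPeriodMap δ Z' (intAct M v))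
    (unif_hol : ∀ (V : Sc.left.affineOpens) (f : Sc.left.presheaf.obj (Opposite.op (↑V : Sc.left.Opens))),
      DifferentiableOn ℂ (fun Z ↦ AlgPoints.evalOrZero (↑V : Sc.left.Opens) f (unif Z))
        (siegelUpperHalfSpace g ∩ unif ⁻¹' {P | P.pt ∈ (↑V : Sc.left.Opens)}))
    -- the (U3) junction for this piece: fibre identification (U3∃) and classification (U3-D3) at every `Z ∈ 𝔥_g`
    (junction : ∀ (u : finAdeleQˣ) (r : gspFinAdelic δ),
      (∀ v, Valued.v ((u : finAdeleQ) v) = 1) →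
      (u : finAdeleQ) - ((c : ZMod N).val : ℕ) ∈ levelIdeal N →
      r ∈ principalLevelSubgroup δ 1 →
      IsMultiplier (typeFormOver δ finAdeleQ) (r : GL (Fin g ⊕ Fin g) finAdeleQ) u →
      ((r : GL (Fin g ⊕ Fin g) finAdeleQ) : Matrix (Fin g ⊕ Fin g) (Fin g ⊕ Fin g) finAdeleQ) =
        Matrix.fromBlocks 1 0 0 ((u : finAdeleQ) • (1 : Matrix (Fin g) (Fin g) finAdeleQ)) →
      ∀ (Z : Matrix (Fin g) (Fin g) ℂ) (hZ : Z ∈ siegelUpperHalfSpace g),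
        haveI : IsLocallyNoetherian (specOver ℚ ℂ).left :=
          inferInstanceAs (IsLocallyNoetherian (Spec (CommRingCat.of ℂ)))
        (∃ (P' : PolarizedAbelianSchemeWithLevel g N δ (specOver ℚ ℂ).left)
            (G : P'.A.X.left ⟶ 𝓜.univ.A.X.left) (Ĝ : P'.D.hat.X.left ⟶ 𝓜.univ.D.hat.X.left),
            P'.IsBaseChangeVia 𝓜.univ
                ((AlgPoints.baseChangeEquiv (algebraMap ℚ ℂ) 𝓜.M).symm (AlgPoints.map ιc (unif Z))).left G Ĝ ∧
            IsAdmissibleAt hδ r Z hZ P') ∧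
        (∀ (P' : PolarizedAbelianSchemeWithLevel g N δ (specOver ℚ ℂ).left), IsAdmissibleAt hδ r Z hZ P' →
            AlgPoints.map ιc (unif Z)
              = AlgPoints.baseChangeEquiv (algebraMap ℚ ℂ) 𝓜.M (𝓜.classifyingMap (specOver ℚ ℂ) P')))
    -- the piece: a compact disc quotient `T` over the Siegel piece, and its slice morphism
    (T : SchemeOver ℂ) (B : UnitaryBallUniformisationDatum 1 T) {Jc : Matrix (Fin 2) (Fin 2) ℂ} (hB : B.Hℂ = Jc) (ψ : T ⟶ Sc)
    -- the holomorphic Siegel lift of `ψ` on the negative cone (★ E6-fac clause 1)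
    (Z : (Fin 2 → ℂ) → Matrix (Fin g) (Fin g) ℂ) (Z_hol : ∀ i j, DifferentiableOn ℂ (fun v => Z v i j) (negCone Jc))
    (Z_mem : ∀ v, v ∈ negCone Jc → Z v ∈ siegelUpperHalfSpace g)
    (hψ : ∀ v, v ∈ negCone Jc → AlgPoints.map ψ (B.unif v) = unif (Z v))
    -- analytifications of `T` (charts on `ℂ`) and of the total space of the pulled-back abelian scheme
    (MT : Type) [TopologicalSpace MT] [ChartedSpace (Fin 1 → ℂ) MT] [IsManifold 𝓘(ℂ, Fin 1 → ℂ) ω MT]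
    (φT : MT → ComplexPoints T) (hT : IsAnalytification (Fin 1 → ℂ) T 1 φT)
    (MA : Type) [TopologicalSpace MA] [ChartedSpace (Fin (1 + g) → ℂ) MA] [IsManifold 𝓘(ℂ, Fin (1 + g) → ℂ) ω MA]
    (φA : MA → ComplexPoints (totalOver T
      (𝓜.univ.baseChange (ψ.left ≫ ιc.left ≫ pullback.fst 𝓜.M.hom (Spec.map (CommRingCat.ofHom (algebraMap ℚ ℂ))))).A))
    (hA : IsAnalytification (Fin (1 + g) → ℂ) (totalOver T
      (𝓜.univ.baseChange (ψ.left ≫ ιc.left ≫ pullback.fst 𝓜.M.hom (Spec.map (CommRingCat.ofHom (algebraMap ℚ ℂ))))).A) (1 + g) φA)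
    -- the total space of the pulled-back abelian scheme is smooth projective (★ E6-Π in the closer)
    (hTot : IsSmoothProjective (1 + g) (totalOver T
      (𝓜.univ.baseChange (ψ.left ≫ ιc.left ≫ pullback.fst 𝓜.M.hom (Spec.map (CommRingCat.ofHom (algebraMap ℚ ℂ))))).A))
    -- a principal representative `(u, r)` of the piece index `c` (the five (U3) premisses)
    (u : finAdeleQˣ) (r : gspFinAdelic δ) (hu : ∀ v, Valued.v ((u : finAdeleQ) v) = 1)
    (huc : (u : finAdeleQ) - ((c : ZMod N).val : ℕ) ∈ levelIdeal N) (hr : r ∈ principalLevelSubgroup δ 1)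
    (hmult : IsMultiplier (typeFormOver δ finAdeleQ) (r : GL (Fin g ⊕ Fin g) finAdeleQ) u)
    (hrmat : ((r : GL (Fin g ⊕ Fin g) finAdeleQ) : Matrix (Fin g ⊕ Fin g) (Fin g ⊕ Fin g) finAdeleQ) =
      Matrix.fromBlocks 1 0 0 ((u : finAdeleQ) • (1 : Matrix (Fin g) (Fin g) finAdeleQ)))
    -- the integral lattice endomorphism, `ℂ`-linear at every cone vector, commuting with the monodromy
    (A : Matrix (Fin g ⊕ Fin g) (Fin g ⊕ Fin g) ℤ)
    (hK : ∀ v ∈ negCone Jc, ∃ Cv : (Fin g → ℂ) →ₗ[ℂ] (Fin g → ℂ),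
      ∀ w : Fin g ⊕ Fin g → ℝ, Cv (siegelPeriodMap δ (Z v) w) = siegelPeriodMap δ (Z v) ((A.map (Int.cast : ℤ → ℝ)) *ᵥ w))
    (htrans : ∀ v ∈ negCone Jc, ∀ v' ∈ negCone Jc, B.unif v = B.unif v' →
      ∃ M ∈ siegelLevelGroup δ N, ∃ L : (Fin g → ℂ) ≃ₗ[ℂ] (Fin g → ℂ),
        (∀ w : Fin g ⊕ Fin g → ℝ, L (siegelPeriodMap δ (Z v) w) = siegelPeriodMap δ (Z v') (intAct M w)) ∧
        (M : Matrix (Fin g ⊕ Fin g) (Fin g ⊕ Fin g) ℤ) * A = A * (M : Matrix (Fin g ⊕ Fin g) (Fin g ⊕ Fin g) ℤ)) :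
    letI P := 𝓜.univ.baseChange (ψ.left ≫ ιc.left ≫ pullback.fst 𝓜.M.hom (Spec.map (CommRingCat.ofHom (algebraMap ℚ ℂ))))
    ∃ (U : MT → Set MT) (σ : MT → MT → (Fin 2 → ℂ))
      (Φ : MT → MT → ((Fin g ⊕ Fin g → ℝ) ≃L[ℝ] (Fin g → ℂ))) (ex : MT → MT × (Fin g → ℂ) → MA)
      (C : MT → MT → ((Fin g → ℂ) →L[ℂ] (Fin g → ℂ))) (Y : P.A.X ⟶ P.A.X),
      -- the section domains cover `MT`
      (∀ i, IsOpen (U i)) ∧ (∀ i, i ∈ U i) ∧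
      -- the sections: cone-valued, lifting `φT` through `unif_B`, complex-differentiable on `U i`
      (∀ i, ∀ t ∈ U i, σ i t ∈ negCone Jc ∧ B.unif (σ i t) = φT t) ∧
      (∀ i, ∀ t ∈ U i, MDifferentiableAt 𝓘(ℂ, Fin 1 → ℂ) 𝓘(ℂ, Fin 2 → ℂ) (σ i) t) ∧
      -- the period family is the tautological one along the lift `Z ∘ σ i`
      (∀ i, ∀ t ∈ U i, ∀ v : Fin g ⊕ Fin g → ℝ, Φ i t v = siegelPeriodMap δ (Z (σ i t)) v) ∧
      -- (C) the charts
      (∀ i, IsRelExpChartOn (Fin 1 → ℂ) (Fin (1 + g) → ℂ) (basePoint hT P.A φA) (U i) (Φ i) (ex i)) ∧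
      -- (G) the fibre maps are additive analytifications of the fibres, read in the total space
      (∀ i, ∀ t ∈ U i, ∃ φt : ComplexTorus (Φ i t) → (P.A.fibre (φT t).left).toAbelianVariety.Points ℂ,
        IsAnalytification (Fin g → ℂ) (P.A.fibre (φT t).left).toAbelianVariety.X g φt ∧
        (∀ x y, φt (x + y) = φt x * φt y) ∧
        ∀ z : Fin g → ℂ, (φA (ex i (t, z))).left = P.A.fibrePointToLeft (φT t).left (φt (cover (Φ i t) z))) ∧
      -- (ADM) the fibre maps ARE admissible markings by `[J(Z (σ i t)), r]`, for every principal representative `r` of `c`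
      (∀ i, ∀ (u : finAdeleQˣ) (r : gspFinAdelic δ),
        (∀ v, Valued.v ((u : finAdeleQ) v) = 1) →
        (u : finAdeleQ) - ((c : ZMod N).val : ℕ) ∈ levelIdeal N →
        r ∈ principalLevelSubgroup δ 1 →
        IsMultiplier (typeFormOver δ finAdeleQ) (r : GL (Fin g ⊕ Fin g) finAdeleQ) u →
        ((r : GL (Fin g ⊕ Fin g) finAdeleQ) : Matrix (Fin g ⊕ Fin g) (Fin g ⊕ Fin g) finAdeleQ) =
          Matrix.fromBlocks 1 0 0 ((u : finAdeleQ) • (1 : Matrix (Fin g) (Fin g) finAdeleQ)) →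
        ∀ (t : MT) (ht : t ∈ U i),
          ∃ (hZt : Z (σ i t) ∈ siegelUpperHalfSpace g)
            (m : SiegelAdelicMarking ⟨jOfSiegel δ (Z (σ i t)), SiegelComplexRecordSystem.jOfSiegel_mem_C0pm hδ.1 hZt⟩ r
              (P.A.fibre (φT t).left).toAbelianVariety)
            (Θ : CartierDivisor (P.A.fibre (φT t).left).toAbelianVariety.X.left)
            (Λ : P.level.SymplecticLift (φT t).left Θ δ),
            Θ.IsAmple ∧ P.A.IsLambdaOfAt (φT t).left P.D P.pol.lam Θ ∧
            (∀ ⦃M : ℕ⦄, N ∣ M → M ≠ 0 → ∀ (x : Fin g ⊕ Fin g → ZMod M) (v : Fin g ⊕ Fin g → ℚ),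
              AdelicCongr ((r⁻¹ : gspFinAdelic δ) : GL (Fin g ⊕ Fin g) finAdeleQ) 1 v (fun i => ((x i).val : ℚ) / M) →
                ((Λ.lift M (Multiplicative.ofAdd x)) : (P.A.fibre (φT t).left).toAbelianVariety.Points ℂ) = m.r v) ∧
            m.γ = 1 ∧ (∀ v : Fin g ⊕ Fin g → ℝ, m.Ψ v = siegelPeriodMap δ (Z (σ i t)) v) ∧
            ∀ z : Fin g → ℂ, P.A.fibrePointToLeft (φT t).left (m.toFun (cover m.Ψ z)) = (φA (ex i (t, z))).left) ∧
      -- the avatar families of `A` along the sections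
      (∀ i, ∀ t ∈ U i, ∀ w : Fin g ⊕ Fin g → ℝ,
        C i t (siegelPeriodMap δ (Z (σ i t)) w) = siegelPeriodMap δ (Z (σ i t)) ((A.map (Int.cast : ℤ → ℝ)) *ᵥ w)) ∧
      -- THE ENDOMORPHISM and its chart recipe
      IsMonHom Y ∧
      ∀ i, ∀ t ∈ U i, ∀ z : Fin g → ℂ, (φA (ex i (t, C i t z))).left = (φA (ex i (t, z))).left ≫ Y.left := by
  let P := 𝓜.univ.baseChange (ψ.left ≫ ιc.left ≫ pullback.fst 𝓜.M.hom (Spec.map (CommRingCat.ofHom (algebraMap ℚ ℂ))))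
  -- instances on the disc quotient `T`
  have hX : IsSmoothProjective 1 T := B.isSmoothProjective
  haveI : SmoothOfRelativeDimension 1 T.hom := hX.smoothOfRelativeDimension
  haveI : IsProper T.hom := IsSmoothProjective.isProper_holds hX
  haveI : IsSeparated T.hom := inferInstance
  haveI : LocallyOfFiniteType T.hom := inferInstance
  haveI : IsIntegral T.left := IsSmoothProjective.isIntegral_holds hX
  haveI : IsReduced T.left := inferInstance
  -- ★ COV-2: charts, sections, (G), (ADM) on the section-domain cover indexed by the points of `MT`
  obtain ⟨U, σ, Φ, ex, hUo, hiU, hσ, hσd, hΦ, hex, hG, hADM⟩ :=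
    exists_univFamilyChartCover_of_piece hP3 g N δ hg hδ hN 𝓜 c Sc ιc unif unif_cont unif_open unif_surj unif_iff unif_hol
      junction T B hB ψ Z Z_hol Z_mem hψ MT φT hT MA φA hA
  -- ★ COV-3∕4: the avatar families along the sections
  have hfam : ∀ i : MT, ∃ Cfam : MT → ((Fin g → ℂ) →L[ℂ] (Fin g → ℂ)),
      MDifferentiableOn 𝓘(ℂ, Fin 1 → ℂ) 𝓘(ℂ, (Fin g → ℂ) →L[ℂ] (Fin g → ℂ)) Cfam (U i) ∧
      (∀ t ∈ U i, ∀ w : Fin g ⊕ Fin g → ℝ,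
        Cfam t (siegelPeriodMap δ (Z (σ i t)) w) = siegelPeriodMap δ (Z (σ i t)) ((A.map (Int.cast : ℤ → ℝ)) *ᵥ w)) ∧
      ∀ t ∈ U i, ∀ n : Fin g ⊕ Fin g → ℤ, Cfam t (Φ i t (fun k => (n k : ℝ))) = Φ i t (fun k => ((A *ᵥ n) k : ℝ)) := fun i =>
    exists_clm_family_along_lift hδ.1 (isOpen_negCone Jc) Z_hol A hK (σ i) (fun t ht => (hσ i t ht).1) (hσd i) (Φ i) (hΦ i)
  choose Cf hCfd hCf hCfN using hfam
  -- ★ COV-5: compatibility on common fibres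
  have hcompat : ∀ i j, ∀ t ∈ U i ∩ U j, ∀ z z' : Fin g → ℂ,
      ex i (t, z) = ex j (t, z') → ex i (t, Cf i t z) = ex j (t, Cf j t z') := by
    intro i j t ht z z' h
    have hti : t ∈ U i := ht.1
    have htj : t ∈ U j := ht.2
    have hunif : B.unif (σ i t) = B.unif (σ j t) := (hσ i t hti).2.trans (hσ j t htj).2.symm
    obtain ⟨M, hM, L, hrel, hMA⟩ := htrans (σ i t) (hσ i t hti).1 (σ j t) (hσ j t htj).1 hunif
    obtain ⟨hZt, m, Θ, Λ, -, hΘl, hΛ, hγ, hΨ, hread⟩ := hADM i u r hu huc hr hmult hrmat t hti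
    obtain ⟨hZt', m', Θ', Λ', -, hΘl', hΛ', hγ', hΨ', hread'⟩ := hADM j u r hu huc hr hmult hrmat t htj
    exact SiegelAdelicMarking.chart_apply_eq_of_chart_eq_of_periodMap_rel_of_injective hg hδ hN hr hZt hZt' m Λ hΘl hΛ
      m' Λ' hΘl' hΛ' hM L hrel hγ hγ' hΨ hΨ' A hMA (Cf i t) (Cf j t) (hCf i t hti) (hCf j t htj) φA
      hA.isHomeomorph.injective (fun z => ex i (t, z)) (fun z => ex j (t, z)) hread hread' h
  -- ★ E6-an′: glue + GAGA + rigidity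
  obtain ⟨Y, hY, hrec⟩ := AbelianSchemeOver.exists_isMonHom_of_chartReadings_of_additive P.A hTot hT hA hex
    (fun t => ⟨t, hiU t⟩) (fun i t ht => by
      obtain ⟨φt, -, hadd, hrd⟩ := hG i t ht
      exact ⟨φt, hadd, hrd⟩)
    Cf hCfd (fun _ _ n => A *ᵥ n) hCfN hcompat
  exact ⟨U, σ, Φ, ex, Cf, Y, hUo, hiU, hσ, hσd, hΦ, hex, hG, hADM, hCf, hY, hrec⟩

end Literature.AlgebraicGeometry.ModuliOfAbelianVarieties

end
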